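import Summits.HodgeConjecture.HodgeConjecture.Theses.PadicSemiregularLift
import Literature.AlgebraicGeometry.KTheory.PullbackVectorBundle
import Summits.HodgeConjecture.HodgeConjecture.Theorems.FormalLiftingFromClassLifting.Negative.OneStepClassLift

/-!
# `FormalVectorBundlesAlgebraize` (stmt-HodgeConjecture-14106) · Negative · tower bookkeeping and tightness

Support lemmas of the standing disprover of crux P3a of route `PadicSemiregularLift`
(refuter-cdisprove-stmt-HodgeConjecture-14106-0, cycle 1, 2026-08-16; work file
`Cruxes/FormalVectorBundlesAlgebraize/Disproof.lean` §§1, 3). The crux says: on a smooth proper model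
`𝒳/W(k)`, a module `E₁` on the special fibre that lifts FORMALLY (`WittScheme.LiftsFormally`: a tower of
vector bundles `E n` on `X_{n+1} = 𝒳 ⊗ W/pⁿ⁺¹`, `E (n+1)|_{X_{n+1}} ≅ E n`, `E 0|_{X_k} ≅ E₁`) lifts
ALGEBRAICALLY (`WittScheme.LiftsTo`). It is Grothendieck's existence theorem (Görtz–Wedhorn II,
Thm 24.94 / Prop 24.95) and resists disproof; what is kernel-checked here is the bookkeeping around it:

* `thickeningMap_comp` — the transition closed immersions `X_a ⟶ X_b ⟶ X_c` of the `p`-adic tower compose;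
* `liftsToThickening_of_liftsFormally` — a formal lift restricts to a vector-bundle lift of `E₁` on EVERY
  finite level `X_{n+1}` (generalises `liftsToThickening_one_of_liftsFormally` of
  `Theorems/FormalLiftingFromClassLifting/Negative/OneStepClassLift`, whose
  `specialFibreToThickening_comp_thickeningMap` is reused); in particular the hypothesis `LiftsFormally`
  is satisfiable only by pull-backs of vector bundles, so the crux's "arbitrary `𝒪`-module `E₁`" is
  harmless;
* `liftsFormally_of_algebraicLift` — TIGHTNESS / the converse direction: a finite locally free
  ALGEBRAIC lift `F` of `E₁` restricts to a formal lift (`E n := F|_{X_{n+1}}`), with no properness or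
  smoothness; so on vector bundles the crux is an equivalence, up to the tree's one-directional bridge
  `IsFiniteLocallyFree → IsVectorBundle` (`Motives/ChernClassesProofs`).

No statement here asserts a Theses decl. The objects `(thickening 𝒳 n).left` are pull-backs only up to
`def` unfolding, so the compatibilities are proved by explicit `Eq.trans` chains through the two
projections rather than by `rw`/`simp` after `pullback.hom_ext`.

References: U. Görtz, T. Wedhorn, *Algebraic Geometry II* (2023), Thm 24.94, Prop 24.95 (p. 566:
"If F is locally free of rank r, then F_{/Z} = (i_n^* F)_n is clearly locally free of rank r");
The Stacks project, Tag 01C8 (pull-back of locally free modules).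
-/

-- `Summit.HodgeConjecture.HodgeConjecture.…` is the prescribed namespace of a single-conjunct summit (D-0017).
set_option linter.dupNamespace false

namespace Summit.HodgeConjecture.HodgeConjecture.Theorems.FormalVectorBundlesAlgebraize.Negative

open CategoryTheory AlgebraicGeometry Limits
open Literature.AlgebraicGeometry.Motives Literature.AlgebraicGeometry.Motives.WittScheme
open Summit.HodgeConjecture.HodgeConjecture.Theorems.FormalLiftingFromClassLifting.Negative
  (specialFibreToThickening_comp_thickeningMap)

noncomputable section

universe u

section Tower

variable {p : ℕ} [Fact p.Prime] {k : Type u} [CommRing k] (𝒳 : SchemeOver (WittVector p k))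

/-- `X_m ⟶ X_n` lies over `Spec W_m ⟶ Spec W_n`: compatibility of the transition map with the second
projections of the fibre products `X_n = 𝒳 ×_W Spec W_n`. [folklore] -/
theorem thickeningMap_snd {m n : ℕ} (h : m ≤ n) :
    thickeningMap 𝒳 h ≫ pullback.snd 𝒳.hom
        (Spec.map (CommRingCat.ofHom (algebraMap (WittVector p k) (wittQuot p k n)))) =
      pullback.snd 𝒳.hom (Spec.map (CommRingCat.ofHom (algebraMap (WittVector p k) (wittQuot p k m)))) ≫
        Spec.map (CommRingCat.ofHom (Ideal.Quotient.factor
          (Ideal.pow_le_pow_right (I := Ideal.span {(p : WittVector p k)}) h))) :=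
  pullback.lift_snd _ _ _

/-- `Spec W_a ⟶ Spec W_b ⟶ Spec W_c` is `Spec W_a ⟶ Spec W_c` (`W_n = W/pⁿ`; transitivity of the
quotient maps, Mathlib `Ideal.Quotient.factor_comp`). [folklore] -/
theorem specMap_factor_comp {a b c : ℕ} (hab : a ≤ b) (hbc : b ≤ c) :
    Spec.map (CommRingCat.ofHom (Ideal.Quotient.factor
        (Ideal.pow_le_pow_right (I := Ideal.span {(p : WittVector p k)}) hab))) ≫
      Spec.map (CommRingCat.ofHom (Ideal.Quotient.factor
        (Ideal.pow_le_pow_right (I := Ideal.span {(p : WittVector p k)}) hbc))) =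
      Spec.map (CommRingCat.ofHom (Ideal.Quotient.factor
        (Ideal.pow_le_pow_right (I := Ideal.span {(p : WittVector p k)}) (hab.trans hbc)))) := by
  rw [← Spec.map_comp, ← CommRingCat.ofHom_comp, Ideal.Quotient.factor_comp]

/-- **The transition closed immersions of the `p`-adic tower compose**: `X_a ⟶ X_b ⟶ X_c` is
`X_a ⟶ X_c` (both are the base change of `𝒳` along `Spec W_a ⟶ Spec W_c`). [folklore] -/
@[reassoc]
theorem thickeningMap_comp {a b c : ℕ} (hab : a ≤ b) (hbc : b ≤ c) :
    thickeningMap 𝒳 hab ≫ thickeningMap 𝒳 hbc = thickeningMap 𝒳 (hab.trans hbc) := by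
  apply pullback.hom_ext
  · exact (Category.assoc _ _ _).trans <|
      ((congrArg (thickeningMap 𝒳 hab ≫ ·) (thickeningMap_ι 𝒳 hbc)).trans
        (thickeningMap_ι 𝒳 hab)).trans (thickeningMap_ι 𝒳 (hab.trans hbc)).symm
  · exact (Category.assoc _ _ _).trans <|
      ((congrArg (thickeningMap 𝒳 hab ≫ ·) (thickeningMap_snd 𝒳 hbc)).trans <|
        (Category.assoc _ _ _).symm.trans <|
        (congrArg (· ≫ Spec.map (CommRingCat.ofHom (Ideal.Quotient.factor
          (Ideal.pow_le_pow_right (I := Ideal.span {(p : WittVector p k)}) hbc))))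
          (thickeningMap_snd 𝒳 hab)).trans <|
        (Category.assoc _ _ _).trans <|
        (congrArg (pullback.snd 𝒳.hom (Spec.map (CommRingCat.ofHom
          (algebraMap (WittVector p k) (wittQuot p k a)))) ≫ ·) (specMap_factor_comp hab hbc))).trans
      (thickeningMap_snd 𝒳 (hab.trans hbc)).symm

end Tower

section Levels

variable {p : ℕ} [Fact p.Prime] {k : Type} [Field k] [CharP k p] (𝒳 : SchemeOver (WittVector p k))

/-- Along a tower `(E n)` with `E (n+1)|_{X_{n+1}} ≅ E n` and `E 0|_{X_k} ≅ E₁`, EVERY level restricts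
to `E₁`: `E n|_{X_k} ≅ E₁` (induction along the tower with Mathlib's pseudofunctoriality isomorphisms
`Scheme.Modules.pullbackComp`, `pullbackCongr` and `specialFibreToThickening_comp_thickeningMap`). [folklore] -/
theorem nonempty_pullback_iso_of_tower {E₁ : (specialFibre 𝒳).left.Modules}
    (E : ∀ n : ℕ, (thickening 𝒳 (n + 1)).left.Modules)
    (hstep : ∀ n, Nonempty ((Scheme.Modules.pullback
      (thickeningMap 𝒳 (Nat.le_succ (n + 1)))).obj (E (n + 1)) ≅ E n))
    (h0 : Nonempty ((Scheme.Modules.pullback (specialFibreToThickening 𝒳 0)).obj (E 0) ≅ E₁))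
    (n : ℕ) :
    Nonempty ((Scheme.Modules.pullback (specialFibreToThickening 𝒳 n)).obj (E n) ≅ E₁) := by
  induction n with
  | zero => exact h0
  | succ n ih =>
    obtain ⟨e⟩ := ih
    obtain ⟨s⟩ := hstep n
    exact ⟨(Scheme.Modules.pullbackCongr
        (specialFibreToThickening_comp_thickeningMap 𝒳 (Nat.le_succ (n + 1))).symm).app _ ≪≫
      (Scheme.Modules.pullbackComp (specialFibreToThickening 𝒳 n)
        (thickeningMap 𝒳 (Nat.le_succ (n + 1)))).symm.app _ ≪≫
      (Scheme.Modules.pullback (specialFibreToThickening 𝒳 n)).mapIso s ≪≫ e⟩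

/-- **Formal lift ⇒ lift to every finite level**: `LiftsFormally 𝒳 E₁ → LiftsToThickening 𝒳 E₁ n`
for all `n` (the `n`-th bundle of the tower restricted along `X_k ⟶ X_{n+1}`). In particular
`LiftsFormally 𝒳 E₁` forces `E₁` to be (isomorphic to) the pull-back of a vector bundle. [folklore] -/
theorem liftsToThickening_of_liftsFormally {E₁ : (specialFibre 𝒳).left.Modules}
    (h : LiftsFormally 𝒳 E₁) (n : ℕ) : LiftsToThickening 𝒳 E₁ n := by
  obtain ⟨E, hE, hstep, h0⟩ := h
  exact ⟨E n, hE n, nonempty_pullback_iso_of_tower 𝒳 E hstep h0 n⟩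

end Levels

section Tightness

variable {p : ℕ} [Fact p.Prime] {k : Type u} [CommRing k] [CharP k p]
  (𝒳 : SchemeOver (WittVector p k))

/-- **Tightness (the converse of the crux).** A finite locally free ALGEBRAIC lift restricts to a
formal lift: if `F` on `𝒳` is finite locally free with `F|_{X_k} ≅ E₁`, then `LiftsFormally 𝒳 E₁`, with
tower `E n := F|_{X_{n+1}}` (Görtz–Wedhorn II, proof of Prop 24.95: "`F_{/Z} = (i_n^* F)_n` is clearly
locally free"; pull-backs of finite locally free modules are finite locally free, Stacks 01C8, tree
`IsFiniteLocallyFree.pullback`). No properness or smoothness of `𝒳` is needed in this direction; the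
hypothesis is `IsFiniteLocallyFree F` rather than `IsVectorBundle F` because the tree proves only the
bridge `IsFiniteLocallyFree.isVectorBundle`. [folklore] -/
theorem liftsFormally_of_algebraicLift {E₁ : (specialFibre 𝒳).left.Modules} (F : 𝒳.left.Modules)
    (hF : IsFiniteLocallyFree F) (e : restrictSpecial 𝒳 F ≅ E₁) : LiftsFormally 𝒳 E₁ := by
  refine ⟨fun n => (Scheme.Modules.pullback (thickeningι 𝒳 (n + 1))).obj F,
    fun n => (hF.pullback _).isVectorBundle, fun n => ⟨?_⟩, ⟨?_⟩⟩
  · exact (Scheme.Modules.pullbackComp (thickeningMap 𝒳 (Nat.le_succ (n + 1)))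
        (thickeningι 𝒳 (n + 2))).app F ≪≫
      (Scheme.Modules.pullbackCongr (thickeningMap_ι 𝒳 (Nat.le_succ (n + 1)))).app F
  · exact (Scheme.Modules.pullbackComp (specialFibreToThickening 𝒳 0) (thickeningι 𝒳 1)).app F ≪≫
      (Scheme.Modules.pullbackCongr (specialFibreToThickening_ι 𝒳 0)).app F ≪≫ e

/-- Corollary: an algebraic finite locally free lift gives a lift to every finite level. [folklore] -/
theorem liftsToThickening_of_algebraicLift {p : ℕ} [Fact p.Prime] {k : Type} [Field k] [CharP k p]
    (𝒳 : SchemeOver (WittVector p k)) {E₁ : (specialFibre 𝒳).left.Modules} (F : 𝒳.left.Modules)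
    (hF : IsFiniteLocallyFree F) (e : restrictSpecial 𝒳 F ≅ E₁) (n : ℕ) :
    LiftsToThickening 𝒳 E₁ n :=
  liftsToThickening_of_liftsFormally 𝒳 (liftsFormally_of_algebraicLift 𝒳 F hF e) n

end Tightness

end

end Summit.HodgeConjecture.HodgeConjecture.Theorems.FormalVectorBundlesAlgebraize.Negative
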